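import Mathlib

/-!
# CentralPathExponentDichotomy — the `μ¹ / μ^½` dichotomy behind the cell's SC census (hubbard-algo crew (5), D-0042
R2(e); companion of `InactiveBlockDepthFloor.lean` / `LevelSlicePairing.lean` and of the census kit j261010
(p1 g6, `HOME/hubbard-algo-p1/kit/runs/j261010/`); elementary real analysis of ONE centred complementarity pair —
NO number and NO bound on any Hubbard quantity lives here)

HONEST FRAMING: first certified bounds; not a superconductivity verdict. On an interior-point central path the
primal and dual blocks commute (`X S = μ·1`), so in a common eigenbasis every eigen-pair is a scalar pair
`x(μ) · s(μ) = μ`. The census classifies the measured eigenvalue curves by their exponent `d log x / d log μ`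
(≈ 0, ≈ 1, or ≈ ½). This file books the exact statements that make that classification an inference about strict
complementarity (SC) of the limit pair `(x*, s*)`:

* `partner_eq_div`, `partner_le_div` — if one side stays `≥ a > 0` the partner is `μ / x ≤ μ / a`: exponent 1;
* `partner_div_tendsto_inv` — if `x(μ) → a > 0` as `μ → 0⁺` then `s(μ)/μ → a⁻¹` (the SC pair: exponents 0 and 1);
* `le_sqrt_of_comparable`, `sqrt_le_of_comparable` — if the two sides stay comparable (`x ≤ c·s`, `s ≤ c·x`) then
  `√(μ/c) ≤ x ≤ √(c·μ)` (and symmetrically for `s`): exponent ½;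
* `limit_eq_zero_of_le_sqrt` — a side that is `O(√μ)` along `μ → 0⁺` and converges has limit `0`;
* `not_strictlyComplementary_of_sqrt_scale` — hence a pair with BOTH sides `O(√μ)` converges (if at all) to
  `x* = s* = 0`: strict complementarity FAILS for that pair. (The converse direction used by the census — an SC pair
  shows exponents 0 and 1 — is `partner_div_tendsto_inv`.)
What is NOT claimed: anything about finitely many iterates (the census sees a window `μ ∈ [1.9e-8, 1.6e-6]`, not a
limit), nor that the measured iterates are exactly centred (they are to ×3, kit j261010 'centrality').
-/

namespace Summit.Ventures.CertifiedManyBodySolver.HubbardAlg.CentralPathExponentDichotomy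

open Filter Topology

/-- On a centred pair `x·s = μ` with `x > 0`, the partner is `s = μ / x`. -/
theorem partner_eq_div {x s μ : ℝ} (hx : 0 < x) (hxs : x * s = μ) : s = μ / x := by
  rw [eq_div_iff (ne_of_gt hx), mul_comm]; exact hxs

/-- **Exponent 1.** On a centred pair `x·s = μ` (`μ ≥ 0`) with `x ≥ a > 0`, the partner satisfies `s ≤ μ / a`. -/
theorem partner_le_div {x s μ a : ℝ} (hμ : 0 ≤ μ) (ha : 0 < a) (hax : a ≤ x) (hxs : x * s = μ) : s ≤ μ / a := by
  have hx : 0 < x := lt_of_lt_of_le ha hax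
  rw [partner_eq_div hx hxs]
  exact div_le_div_of_nonneg_left hμ ha hax

/-- **The SC pair (exponents 0 and 1).** If `x(μ)·s(μ) = μ` for `μ > 0` and `x(μ) → a > 0` as `μ → 0⁺`, then
`s(μ)/μ → a⁻¹`: the partner decays exactly linearly in `μ`. -/
theorem partner_div_tendsto_inv {x s : ℝ → ℝ} {a : ℝ} (ha : 0 < a)
    (hxs : ∀ μ, 0 < μ → x μ * s μ = μ) (hx : Tendsto x (𝓝[>] (0 : ℝ)) (𝓝 a)) :
    Tendsto (fun μ => s μ / μ) (𝓝[>] (0 : ℝ)) (𝓝 a⁻¹) := by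
  have hinv : Tendsto (fun μ => (x μ)⁻¹) (𝓝[>] (0 : ℝ)) (𝓝 a⁻¹) := hx.inv₀ (ne_of_gt ha)
  refine hinv.congr' ?_
  have hpos : ∀ᶠ μ in 𝓝[>] (0 : ℝ), 0 < μ := self_mem_nhdsWithin
  have hxa : ∀ᶠ μ in 𝓝[>] (0 : ℝ), a / 2 < x μ := hx.eventually (lt_mem_nhds (by linarith))
  filter_upwards [hpos, hxa] with μ hμ hμx
  have hxpos : 0 < x μ := lt_trans (by linarith) hμx
  rw [partner_eq_div hxpos (hxs μ hμ)]
  field_simp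

/-- **Exponent ½, upper side.** If `x·s = μ`, `0 ≤ x` and `x ≤ c·s` then `x ≤ √(c·μ)`. -/
theorem sqrt_le_of_comparable {x s μ c : ℝ} (hx : 0 ≤ x) (hxs : x * s = μ) (hc : x ≤ c * s) :
    x ≤ Real.sqrt (c * μ) := by
  have h2 : x ^ 2 ≤ c * μ := by
    calc x ^ 2 = x * x := by ring
      _ ≤ x * (c * s) := mul_le_mul_of_nonneg_left hc hx
      _ = c * (x * s) := by ring
      _ = c * μ := by rw [hxs]
  calc x = Real.sqrt (x ^ 2) := (Real.sqrt_sq hx).symm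
    _ ≤ Real.sqrt (c * μ) := Real.sqrt_le_sqrt h2

/-- **Exponent ½, lower side.** If `x·s = μ`, `0 ≤ x`, `0 < c` and `s ≤ c·x` then `√(μ/c) ≤ x`. -/
theorem le_sqrt_of_comparable {x s μ c : ℝ} (hx : 0 ≤ x) (hc0 : 0 < c) (hxs : x * s = μ) (hc : s ≤ c * x) :
    Real.sqrt (μ / c) ≤ x := by
  have h2 : μ / c ≤ x ^ 2 := by
    rw [div_le_iff₀ hc0]
    calc μ = x * s := hxs.symm
      _ ≤ x * (c * x) := mul_le_mul_of_nonneg_left hc hx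
      _ = x ^ 2 * c := by ring
  calc Real.sqrt (μ / c) ≤ Real.sqrt (x ^ 2) := Real.sqrt_le_sqrt h2
    _ = x := Real.sqrt_sq hx

/-- A nonnegative quantity that is `O(√μ)` as `μ → 0⁺` and converges has limit `0`. -/
theorem limit_eq_zero_of_le_sqrt {x : ℝ → ℝ} {a C : ℝ} (hx : Tendsto x (𝓝[>] (0 : ℝ)) (𝓝 a))
    (hnn : ∀ᶠ μ in 𝓝[>] (0 : ℝ), 0 ≤ x μ) (hle : ∀ᶠ μ in 𝓝[>] (0 : ℝ), x μ ≤ C * Real.sqrt μ) : a = 0 := by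
  have hsqrt : Tendsto (fun μ : ℝ => C * Real.sqrt μ) (𝓝[>] (0 : ℝ)) (𝓝 0) := by
    have h1 : Tendsto (fun μ : ℝ => Real.sqrt μ) (𝓝 (0 : ℝ)) (𝓝 (Real.sqrt 0)) :=
      Real.continuous_sqrt.tendsto 0
    rw [Real.sqrt_zero] at h1
    have h2 : Tendsto (fun μ : ℝ => C * Real.sqrt μ) (𝓝 (0 : ℝ)) (𝓝 (C * 0)) := h1.const_mul C
    rw [mul_zero] at h2
    exact tendsto_nhdsWithin_of_tendsto_nhds h2
  have hzero : Tendsto x (𝓝[>] (0 : ℝ)) (𝓝 0) :=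
    tendsto_of_tendsto_of_tendsto_of_le_of_le' tendsto_const_nhds hsqrt hnn hle
  exact tendsto_nhds_unique hx hzero

/-- **The census inference.** A centred eigen-pair whose two sides are BOTH `O(√μ)` as `μ → 0⁺` (the measured
'exponent ½' class) and which converges, converges to `x* = 0` AND `s* = 0`: strict complementarity (`x* + s* > 0`)
fails for that pair. -/
theorem not_strictlyComplementary_of_sqrt_scale {x s : ℝ → ℝ} {a b C : ℝ}
    (hx : Tendsto x (𝓝[>] (0 : ℝ)) (𝓝 a)) (hs : Tendsto s (𝓝[>] (0 : ℝ)) (𝓝 b))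
    (hxnn : ∀ᶠ μ in 𝓝[>] (0 : ℝ), 0 ≤ x μ) (hsnn : ∀ᶠ μ in 𝓝[>] (0 : ℝ), 0 ≤ s μ)
    (hxle : ∀ᶠ μ in 𝓝[>] (0 : ℝ), x μ ≤ C * Real.sqrt μ) (hsle : ∀ᶠ μ in 𝓝[>] (0 : ℝ), s μ ≤ C * Real.sqrt μ) :
    a = 0 ∧ b = 0 ∧ ¬ (0 < a + b) :=
  have ha : a = 0 := limit_eq_zero_of_le_sqrt hx hxnn hxle
  have hb : b = 0 := limit_eq_zero_of_le_sqrt hs hsnn hsle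
  ⟨ha, hb, by rw [ha, hb]; simp⟩

/-- **Comparable pairs are `O(√μ)` on both sides** (so the previous theorem applies): if `x·s = μ` with `x, s ≥ 0`
and `x ≤ c·s`, `s ≤ c·x` for every `μ > 0`, then both sides are `≤ √c · √μ`. -/
theorem both_le_sqrt_of_comparable {x s : ℝ → ℝ} {c : ℝ} (hc0 : 0 ≤ c)
    (h : ∀ μ, 0 < μ → x μ * s μ = μ ∧ 0 ≤ x μ ∧ 0 ≤ s μ ∧ x μ ≤ c * s μ ∧ s μ ≤ c * x μ) :
    (∀ᶠ μ in 𝓝[>] (0 : ℝ), x μ ≤ Real.sqrt c * Real.sqrt μ) ∧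
      (∀ᶠ μ in 𝓝[>] (0 : ℝ), s μ ≤ Real.sqrt c * Real.sqrt μ) := by
  have hpos : ∀ᶠ μ in 𝓝[>] (0 : ℝ), 0 < μ := self_mem_nhdsWithin
  constructor
  · filter_upwards [hpos] with μ hμ
    obtain ⟨hxs, hx, -, hxc, -⟩ := h μ hμ
    have := sqrt_le_of_comparable hx hxs hxc
    rwa [Real.sqrt_mul hc0] at this
  · filter_upwards [hpos] with μ hμ
    obtain ⟨hxs, -, hs, -, hsc⟩ := h μ hμ
    have hsx : s μ * x μ = μ := by rw [mul_comm]; exact hxs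
    have := sqrt_le_of_comparable hs hsx hsc
    rwa [Real.sqrt_mul hc0] at this

end Summit.Ventures.CertifiedManyBodySolver.HubbardAlg.CentralPathExponentDichotomy
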